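import Literature.NumberTheory.LFunctions.PretentiousZeta
import Literature.NumberTheory.LFunctions.ZetaOneLineBounds
import Literature.NumberTheory.Sieve.SmoothSaddlePoint
import HarnessLib

/-!
# The small primes' share of the decay sum `W(τ) = Σ_{p ≤ y} p^{-σ}(1 - cos(τ log p))` (Hildebrand–Tenenbaum, Lemma 6/8)

Topic `Literature/NumberTheory/Sieve`; a PROVED tool file toward Hildebrand–Tenenbaum's saddle-point theorem
[HildebrandTenenbaum1986, Thm 1]. Op. cit. bound `|ζ(s, y)/ζ(α, y)| ≤ e^{-W}`,
`W = Σ_{p ≤ y} p^{-α}(1 - cos(τ log p))` (tree: `norm_smoothZetaC_le_mul_exp_neg_decaySum`), from below through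
their Lemma 6 — the prime number theorem for `Σ_{n ≤ y} Λ(n) n^{-s}` with Vinogradov's zero-free region — because they
need `|τ|` as large as `exp((log y)^{3/2-ε})` AND `Re s = α` possibly far to the left of `1`. For the primes `p ≤ x`
weighted by `1/p` (which is all that is needed to the RIGHT of `1`, i.e. for the factor `1/log y` in the decay of
`ζ(α + iτ, y)` when `α` is close to `1`), no zero-free region is required: the Euler product on the line
`σ_x = 1 + 1/log x` and the convexity bound `ζ(σ + it) ≪ log|t|` give

* `exists_sum_one_sub_cos_div_prime_ge_of_three_le` — there are absolute `C, x₀` with, for `x ≥ x₀`, `|u| ≥ 3`: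
  **`Σ_{p ≤ x} (1 - cos(u log p))/p ≥ log log x - log log|u| - C`**;
* `exists_sum_one_sub_cos_div_prime_ge_of_le_three` — for `x ≥ x₀`, `1/log x ≤ |u| ≤ 3`:
  **`Σ_{p ≤ x} (1 - cos(u log p))/p ≥ log(|u| log x) - C`**

(both from the tree's distance formula `|𝔻(1, n^{iu}; x)² - (log log x - log|ζ(σ_x - iu)|)| ≤ C`,
`Literature.NumberTheory.LFunctions.exists_pretentiousDistSq_one_zeta_approx`, with `𝔻(1, n^{iu}; x)² = Σ_{p ≤ x}(1 - cos(u log p))/p`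
(`pretentiousDistSq_one_twist_eq_sum`, with `Re p^{iu} = cos(u log p)`), and the bounds `|ζ(σ + it)| ≤ 21 log|t|` (`|t| ≥ 3`,
`ZetaOneLine.norm_riemannZeta_le_log`), `|ζ(s) - 1/(s-1)| ≤ M` on `[1,2] × [-2,2]`
(`exists_bound_riemannZeta_sub_inv`) and `|ζ| ≤ M'` on `[1,2] × {2 ≤ |t| ≤ 3}` (compactness,
`exists_bound_riemannZeta_two_three`)); and the comparison with Hildebrand–Tenenbaum's sum:

* `sum_one_sub_cos_div_le_decaySum` — for `σ ≤ 1` and `⌊x⌋₊ ≤ y`: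
  `Σ_{p ≤ x} (1 - cos(τ log p))/p ≤ Σ_{p ≤ y} p^{-σ}(1 - cos(τ log p))` (`p^{-σ} ≥ 1/p`, positivity of the rest).

## References

* [HildebrandTenenbaum1986] A. Hildebrand, G. Tenenbaum, Trans. AMS 296 (1986) 265–290, §3 Lemma 6 and its
  Corollary, Lemma 8 (ii) and the proof of (3.16) (held: `paper:doi-10-1090-s0002-9947-1986-0837811-1`, pp. 274–276).
* E. C. Titchmarsh, *The Theory of the Riemann Zeta-Function*, 2nd ed., OUP 1986, Thm 3.5 (as in the tree's
  `ZetaOneLineBounds`).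

## Tree / Mathlib

Tree: `Literature.NumberTheory.LFunctions.exists_pretentiousDistSq_one_zeta_approx`, `sigmaX`, `one_lt_sigmaX`, `sigmaX_le_two`,
`exists_bound_riemannZeta_sub_inv` (`PretentiousZeta`); `Literature.NumberTheory.Sieve.pretentiousDistSq`, `twistedChar`
(`PretentiousDistance`); `Literature.NumberTheory.LFunctions.ZetaOneLine.norm_riemannZeta_le_log` (`ZetaOneLineBounds`).
Mathlib: `riemannZeta_ne_zero_of_one_le_re`, `differentiableAt_riemannZeta`, `IsCompact.exists_bound_of_continuousOn`,
`Complex.exp_ofReal_mul_I_re` (as in the tree's `Literature.NumberTheory.LFunctions.re_natCast_cpow_mul_I`).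
-/

noncomputable section

open Complex Finset Real

namespace Literature.NumberTheory.Sieve

open Literature.NumberTheory.LFunctions

/-! ### `𝔻(1, n^{iu}; x)²` is the sum `Σ_{p ≤ x} (1 - cos(u log p))/p` -/

/-- `𝔻(1, n^{iu}; x)² = Σ_{p ≤ x} (1 - cos(u log p))/p` (`n^{iu} = twistedChar 1 u`). [folklore] -/
theorem pretentiousDistSq_one_twist_eq_sum (u x : ℝ) :
    pretentiousDistSq 1 (twistedChar (1 : DirichletCharacter ℂ 1) u) x =
      ∑ p ∈ Nat.primesLE ⌊x⌋₊, (1 - Real.cos (u * Real.log p)) / p := by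
  unfold pretentiousDistSq twistedChar
  refine Finset.sum_congr rfl fun p hp => ?_
  have hp0 : 0 < p := (Nat.mem_primesLE.1 hp).2.pos
  -- `Re(p^{iu}) = cos(u log p)` (the tree's `Literature.NumberTheory.LFunctions.re_natCast_cpow_mul_I` lives in the heavy
  -- `LiouvilleNonpretentious`; re-derived inline)
  have hre : ((p : ℂ) ^ ((u : ℂ) * I)).re = Real.cos (u * Real.log p) := by
    have hp0' : (p : ℂ) ≠ 0 := by exact_mod_cast hp0.ne'
    rw [Complex.cpow_def_of_ne_zero hp0', show (p : ℂ) = ((p : ℝ) : ℂ) by norm_cast,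
      (Complex.ofReal_log (Nat.cast_nonneg p)).symm, show ((Real.log p : ℝ) : ℂ) * ((u : ℂ) * I) =
        ((u * Real.log p : ℝ) : ℂ) * I by push_cast; ring, Complex.exp_ofReal_mul_I_re]
  simp only [Pi.one_apply, one_mul, Complex.conj_re, dirichletCharacter_modOne_apply]
  rw [hre]

/-! ### `ζ` is bounded on `[1, 2] × {2 ≤ |t| ≤ 3}` -/

/-- `ζ(s)` is bounded on the compact set `1 ≤ Re s ≤ 2`, `2 ≤ |Im s| ≤ 3` (where it is continuous).
[folklore] -/
theorem exists_bound_riemannZeta_two_three :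
    ∃ M : ℝ, 1 ≤ M ∧ ∀ s : ℂ, 1 ≤ s.re → s.re ≤ 2 → 2 ≤ |s.im| → |s.im| ≤ 3 → ‖riemannZeta s‖ ≤ M := by
  set K : Set ℂ := (Set.Icc (1 : ℝ) 2 ×ℂ (Set.Icc (2 : ℝ) 3 ∪ Set.Icc (-3 : ℝ) (-2))) with hK
  have hKc : IsCompact K := IsCompact.reProdIm isCompact_Icc (isCompact_Icc.union isCompact_Icc)
  have hcont : ContinuousOn riemannZeta K := by
    refine fun s hs => (differentiableAt_riemannZeta ?_).continuousAt.continuousWithinAt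
    intro h1
    have him : s.im ∈ Set.Icc (2 : ℝ) 3 ∪ Set.Icc (-3 : ℝ) (-2) := hs.2
    rw [h1, Complex.one_im] at him
    rcases him with h | h <;> simp only [Set.mem_Icc] at h <;> linarith [h.1, h.2]
  obtain ⟨M, hM⟩ := hKc.exists_bound_of_continuousOn hcont
  refine ⟨max M 1, le_max_right _ _, fun s h1 h2 h3 h4 => le_trans (hM s ⟨⟨h1, h2⟩, ?_⟩) (le_max_left _ _)⟩
  rcases le_or_gt 0 s.im with him | him
  · left; rw [abs_of_nonneg him] at h3 h4; exact ⟨h3, h4⟩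
  · right; rw [abs_of_neg him] at h3 h4; exact ⟨by linarith, by linarith⟩

/-! ### The small primes' share of `W` -/

/-- **`Σ_{p ≤ x} (1 - cos(u log p))/p ≥ log log x - log log|u| - C` for `|u| ≥ 3`, `x ≥ x₀`** (absolute `C, x₀`):
the distance formula `𝔻(1, n^{iu}; x)² = log log x - log|ζ(σ_x - iu)| + O(1)` (Euler product on `σ_x = 1 + 1/log x`,
tree) and `|ζ(σ_x - iu)| ≤ 21 log|u|` (Titchmarsh Thm 3.5, tree). This is the `1/p`-weighted part of
Hildebrand–Tenenbaum's lower bound for `W` (their Corollary to Lemma 6), valid here for ALL `|u| ≥ 3` with no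
zero-free region. [cite: HildebrandTenenbaum1986, §3 Lemma 6 (Corollary) and Lemma 8 (ii)] -/
theorem exists_sum_one_sub_cos_div_prime_ge_of_three_le :
    ∃ C x₀ : ℝ, 3 ≤ x₀ ∧ ∀ x : ℝ, x₀ ≤ x → ∀ u : ℝ, 3 ≤ |u| →
      Real.log (Real.log x) - Real.log (Real.log |u|) - C ≤
        ∑ p ∈ Nat.primesLE ⌊x⌋₊, (1 - Real.cos (u * Real.log p)) / p := by
  obtain ⟨x₀, C₀, hx₀3, hD⟩ := exists_pretentiousDistSq_one_zeta_approx
  refine ⟨C₀ + Real.log 21, x₀, hx₀3, fun x hx u hu => ?_⟩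
  have hx1 : (1 : ℝ) < x := by linarith
  have h := hD x hx u
  rw [pretentiousDistSq_one_twist_eq_sum] at h
  have habs := (abs_le.1 h).1
  -- `|ζ(σ_x - iu)| ≤ 21 log|u|`
  set s : ℂ := (sigmaX x : ℂ) - u * I with hs
  have hsre : s.re = sigmaX x := by simp [hs]
  have hsim : s.im = -u := by simp [hs]
  have hσ1 : 1 < s.re := by rw [hsre]; exact one_lt_sigmaX hx1
  have hlogu : 1 < Real.log |u| :=
    MertensBound.one_lt_log_three.trans_le (Real.log_le_log (by norm_num) hu)
  have hζ : ‖riemannZeta s‖ ≤ 21 * Real.log |u| := by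
    have him : 3 ≤ |s.im| := by rw [hsim, abs_neg]; exact hu
    have h := ZetaOneLine.norm_riemannZeta_le_log him (by
      rw [hsim, abs_neg]
      have : 0 < 1 / (2 * Real.log |u|) := by positivity
      linarith)
    rwa [hsim, abs_neg] at h
  have hζ0 : 0 < ‖riemannZeta s‖ := norm_pos_iff.2 (riemannZeta_ne_zero_of_one_le_re hσ1.le)
  have hlogζ : Real.log ‖riemannZeta s‖ ≤ Real.log 21 + Real.log (Real.log |u|) := by
    rw [← Real.log_mul (by norm_num) (by linarith)]
    exact Real.log_le_log hζ0 hζ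
  linarith

/-- **`Σ_{p ≤ x} (1 - cos(u log p))/p ≥ log(|u| log x) - C` for `1/log x ≤ |u| ≤ 3`, `x ≥ x₀`** (absolute `C, x₀`):
the distance formula and `|ζ(σ_x - iu)| ≤ 1/|u| + M` for `|u| ≤ 2` (the pole: `|ζ(s) - 1/(s-1)| ≤ M` on
`[1,2] × [-2,2]`), resp. `|ζ(σ_x - iu)| ≤ M'` for `2 ≤ |u| ≤ 3` (compactness). For `|u| log x ≍ 1` the bound is
trivial; it says that between the scales `1/log x` and `1` the primes `p ≤ x` already see the oscillation of
`n^{iu}`. [cite: HildebrandTenenbaum1986, §3 Lemma 6 (Corollary) and Lemma 8 (ii)] -/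
theorem exists_sum_one_sub_cos_div_prime_ge_of_le_three :
    ∃ C x₀ : ℝ, 3 ≤ x₀ ∧ ∀ x : ℝ, x₀ ≤ x → ∀ u : ℝ, 1 / Real.log x ≤ |u| → |u| ≤ 3 →
      Real.log (|u| * Real.log x) - C ≤
        ∑ p ∈ Nat.primesLE ⌊x⌋₊, (1 - Real.cos (u * Real.log p)) / p := by
  obtain ⟨x₀, C₀, hx₀3, hD⟩ := exists_pretentiousDistSq_one_zeta_approx
  obtain ⟨M, hM0, hM⟩ := exists_bound_riemannZeta_sub_inv
  obtain ⟨M', hM'1, hM'⟩ := exists_bound_riemannZeta_two_three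
  refine ⟨C₀ + Real.log (1 + 2 * M) + Real.log M' + Real.log 3, max x₀ (Real.exp 1), le_trans hx₀3 (le_max_left _ _),
    fun x hx u hu1 hu3 => ?_⟩
  have hx₀ : x₀ ≤ x := le_trans (le_max_left _ _) hx
  have hxe : Real.exp 1 ≤ x := le_trans (le_max_right _ _) hx
  have hx1 : (1 : ℝ) < x := by linarith [hx₀3]
  have hlogx : 1 ≤ Real.log x := by
    rw [Real.le_log_iff_exp_le (by linarith)]; exact hxe
  have hlogx0 : 0 < Real.log x := by linarith
  have hu0 : 0 < |u| := lt_of_lt_of_le (by positivity) hu1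
  have h := hD x hx₀ u
  rw [pretentiousDistSq_one_twist_eq_sum] at h
  have habs := (abs_le.1 h).1
  set s : ℂ := (sigmaX x : ℂ) - u * I with hs
  have hsre : s.re = sigmaX x := by simp [hs]
  have hsim : s.im = -u := by simp [hs]
  have hσ1 : 1 < s.re := by rw [hsre]; exact one_lt_sigmaX hx1
  have hσ2 : s.re ≤ 2 := by rw [hsre]; exact sigmaX_le_two hxe
  have hζ0 : 0 < ‖riemannZeta s‖ := norm_pos_iff.2 (riemannZeta_ne_zero_of_one_le_re hσ1.le)
  -- constants are nonnegative
  have hlog12M : 0 ≤ Real.log (1 + 2 * M) := Real.log_nonneg (by linarith)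
  have hlogM' : 0 ≤ Real.log M' := Real.log_nonneg hM'1
  have hlog3 : 0 ≤ Real.log 3 := Real.log_nonneg (by norm_num)
  have hloguL : Real.log (|u| * Real.log x) = Real.log |u| + Real.log (Real.log x) :=
    Real.log_mul hu0.ne' hlogx0.ne'
  rcases le_or_gt |u| 2 with hu2 | hu2
  · -- `|u| ≤ 2`: the pole term
    have hs1 : s ≠ 1 := by
      intro h1; have := congrArg Complex.re h1; rw [hsre, Complex.one_re] at this; linarith
    have him2 : |s.im| ≤ 2 := by rw [hsim, abs_neg]; exact hu2
    have hpole := hM s hσ1.le hσ2 him2 hs1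
    -- `‖(s-1)⁻¹‖ ≤ 1/|u|`
    have hinv : ‖(s - 1)⁻¹‖ ≤ 1 / |u| := by
      rw [norm_inv, one_div]
      refine inv_anti₀ hu0 ?_
      calc |u| = |(s - 1).im| := by simp [hsim]
        _ ≤ ‖s - 1‖ := Complex.abs_im_le_norm _
    have hζle : ‖riemannZeta s‖ ≤ (1 + 2 * M) / |u| := by
      have h1 : ‖riemannZeta s‖ ≤ ‖(s - 1)⁻¹‖ + M := by
        have := norm_sub_norm_le (riemannZeta s) ((s - 1)⁻¹); linarith
      have h2 : M ≤ 2 * M / |u| := by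
        rw [le_div_iff₀ hu0]; nlinarith
      calc ‖riemannZeta s‖ ≤ 1 / |u| + 2 * M / |u| := by linarith
        _ = (1 + 2 * M) / |u| := by ring
    have hlogζ : Real.log ‖riemannZeta s‖ ≤ Real.log (1 + 2 * M) - Real.log |u| := by
      rw [← Real.log_div (by linarith) hu0.ne']
      exact Real.log_le_log hζ0 hζle
    rw [hloguL]
    linarith
  · -- `2 < |u| ≤ 3`: `ζ` bounded by `M'`
    have hζle : ‖riemannZeta s‖ ≤ M' := hM' s hσ1.le hσ2 (by rw [hsim, abs_neg]; exact hu2.le)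
      (by rw [hsim, abs_neg]; exact hu3)
    have hlogζ : Real.log ‖riemannZeta s‖ ≤ Real.log M' := Real.log_le_log hζ0 hζle
    have hlogu : Real.log |u| ≤ Real.log 3 := Real.log_le_log hu0 hu3
    rw [hloguL]
    linarith

/-! ### Comparison with Hildebrand–Tenenbaum's `W` -/

/-- **The small primes inside `W`**: for `σ ≤ 1` and `⌊x⌋₊ ≤ y`,
`Σ_{p ≤ x} (1 - cos(τ log p))/p ≤ Σ_{p ≤ y} p^{-σ} (1 - cos(τ log p))` (`1/p ≤ p^{-σ}`, and the primes
`x < p ≤ y` contribute nonnegatively). Combined with `norm_smoothZetaC_le_mul_exp_neg_decaySum` and the two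
theorems above: `|ζ(σ + iτ, y)| ≤ e^{C} ζ(σ, y) · log|τ|/log x` (`|τ| ≥ 3`), resp. `≤ e^{C} ζ(σ, y)/(|τ| log x)`
(`1/log x ≤ |τ| ≤ 3`), for every `x₀ ≤ x ≤ y`. [cite: HildebrandTenenbaum1986, §3 Lemma 8 (ii), proof of (3.16)] -/
theorem sum_one_sub_cos_div_le_decaySum {σ x τ : ℝ} {y : ℕ} (hσ1 : σ ≤ 1) (hxy : ⌊x⌋₊ ≤ y) :
    ∑ p ∈ Nat.primesLE ⌊x⌋₊, (1 - Real.cos (τ * Real.log p)) / p ≤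
      ∑ p ∈ Nat.primesLE y, (p : ℝ) ^ (-σ) * (1 - Real.cos (τ * Real.log p)) := by
  have hsub : Nat.primesLE ⌊x⌋₊ ⊆ Nat.primesLE y := by
    intro p hp
    obtain ⟨hpx, hpp⟩ := Nat.mem_primesLE.1 hp
    exact Nat.mem_primesLE.2 ⟨hpx.trans hxy, hpp⟩
  have hcos : ∀ p : ℕ, 0 ≤ 1 - Real.cos (τ * Real.log p) := fun p => by linarith [Real.cos_le_one (τ * Real.log p)]
  refine le_trans (Finset.sum_le_sum fun p hp => ?_)
    (Finset.sum_le_sum_of_subset_of_nonneg hsub fun p hp _ => ?_)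
  · obtain ⟨-, hpp⟩ := Nat.mem_primesLE.1 hp
    have hp1 : (1 : ℝ) ≤ p := by exact_mod_cast hpp.one_lt.le
    have hp0 : (0 : ℝ) < p := by linarith
    rw [div_eq_inv_mul, ← Real.rpow_neg_one]
    exact mul_le_mul_of_nonneg_right (Real.rpow_le_rpow_of_exponent_le hp1 (by linarith)) (hcos p)
  · obtain ⟨-, hpp⟩ := Nat.mem_primesLE.1 hp
    have hp0 : (0 : ℝ) ≤ p := Nat.cast_nonneg p
    exact mul_nonneg (Real.rpow_nonneg hp0 _) (hcos p)

end Literature.NumberTheory.Sieve
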